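import Summits.QuantumFields.YangMills.Theorems.BalabanUVNodesN19SegmentThreeLines
import Summits.QuantumFields.YangMills.Theorems.BalabanUVNodesN19ExpectationCurrencyTwoConstants
import Summits.QuantumFields.YangMills.Theorems.BalabanUVNodesN19LawSummabilityThreshold
import Summits.QuantumFields.YangMills.Theorems.BalabanUVNodesN19NoLinearPrice

/-!
# N19 (NE7, s3 ALTERNATIVE CURRENCY) — THE EXPECTATION PRICE OF THE WINDOW CURRENCY IS `ε·L∕log L`: the log-log gap closes on the UPPER side

Module 105 of the `dag-n19-e` lineage; settles CURRENCY-MAP v4's open item «the log-log gap of the expectation currency» (open since g10).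
THE GAP: p480837 (`…N19ExpectationCurrencyTwoConstants.abs_integral_sub_integral_le_linlog_of_cgf_close`): observables `|X|, |Y| ≤ B`, cgf's
`ε`-close on `|t| < l₀` ⇒ `|E Y − E X| ≤ 4e^{1+l₀B}·ε·(1 + L)∕l₀`, `L = log⁺ε⁻¹` (two constants on the disc `|z| ≤ l₀` against its diameter);
p509390 ∕ p511222 (`…N19NoLinearPrice*`): grid-Chebyshev laws with `|E_ν − E_μ| ≥ (Me^{−2l₀}∕l₀)·ε` at `L ≍ M·log(M∕l₀)`, i.e. `≍ ε·L∕log(L∕l₀)`;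
the `log log` in between was left open («a family without the log log would need non-grid extremal signed measures»).

★★★ `abs_integral_sub_integral_le_loglog_of_cgf_close`: for `|X|, |Y| ≤ B` a.e. (`B > 0`), cgf's `ε`-close on the CLOSED window `|t| ≤ l₀`
(`0 < ε ≤ 1`, `L = log ε⁻¹`): `|E Y − E X| ≤ 2e^{1+l₀B}·ε·(3L + 2 + Bl₀)∕(l₀·log(2 + 2(L+1)∕(Bl₀)))` — of the order `ε·L∕log(L∕(Bl₀))`, the
order of the grid witnesses: THE LOWER BOUND WAS SHARP, THE UPPER BOUND WAS NOT.  Why p480837's «log not removable» does not apply: it is sharp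
for functions holomorphic on the disc `|z| ≤ l₀` only, whereas a difference of mgfs of laws on `[−B,B]` is ENTIRE OF EXPONENTIAL TYPE `B`
(`‖f(z)‖ ≤ 2e^{B‖z‖}`), and seen from the strip `|Im w| ≤ Y ≍ log(L∕(Bl₀))` of the cosine parametrisation `z = l₀cos w` (module 104: Hadamard
three lines + Cauchy at `w = π∕2`) the short segment costs only `log(M_Y∕m)∕Y ≍ L∕log(L∕(Bl₀))`.

§2 cashes it for N19's DECL-target shape: ★ `abs_mean_increment_le_loglog_of_matchingModConstants` — along any sequence of laws on `[−1,1]` with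
`MatchingModConstants vol l₀ δ (K t ↦ mgf λ_K t)` the means move by `≤ 2e^{1+l₀}·(2volδ_K)·(3L_K + 2 + l₀)∕(l₀·log(2 + 2(L_K+1)∕l₀))`,
`L_K = log(2volδ_K)⁻¹` (steps with `2volδ_K ≤ 1`).  READING (two-sided, honest): with p509390's witnesses the exchange rate WINDOW `ε` → EXPECTATION
is `Θ_{l₀}(ε·L∕log L)` as `ε → 0` — CURRENCY-MAP row 1 becomes two-sided with matching orders; constants not optimised.

HONEST FRAMING (binding).  [folklore] complex analysis ∕ probability over Mathlib + the lineage BY NAME (module 104; p480837 §2's mgf bookkeeping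
`norm_complexMGF_sub_complexMGF_le` ∕ `abs_mgf_sub_mgf_le_of_cgf_close`; `T4GenFunBounds`; module 74's `cgf_increment_le_of_matchingModConstants`; p509390's witnesses BY NAME in §3);
TOY ∕ abstract laws, no scheme object, no Theses import; a statement about the SHAPE of N19's DECL target; NO consumer in the DAG today (the apex
consumes existence of limits, not rates); nothing of Bałaban's instantiated; NE7 NOT PRINTED, NOT proved; N19 NOT discharged; count-neutral.  One
finite `T⁴` programme at fixed `ε`; nothing continuum ∕ `ℝ⁴` ∕ OS ∕ mass-gap ∕ Clay.  0 `def` ∕ 0 `sorry`.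
-/

noncomputable section

open Set Metric Filter Topology MeasureTheory ProbabilityTheory Complex Real

namespace Summit.QuantumFields.YangMills.Theorems.BalabanUVNodesN19ExpectationCurrencyLogLog

open Literature.MathematicalPhysics.QuantumFieldTheory.Balaban1983to89
open T4CauchySum (MatchingModConstants)
open BalabanUVNodesN19SegmentThreeLines (norm_deriv_le_segment_far)
open Summit.QuantumFields.YangMills.BalabanUVNodes.N19ExpectationCurrencyTwoConstants
  (norm_complexMGF_sub_complexMGF_le abs_mgf_sub_mgf_le_of_cgf_close)
open BalabanUVNodesN19LawSummabilityThreshold (cgf_increment_le_of_matchingModConstants)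
open BalabanUVNodesN19NoLinearPrice (exists_cgf_close_means_far)
open BalabanUVNodesN19LawPriceSymmetric (ae_abs_le_one_of_Icc_symm)

/-! ## §1 Two probability spaces: close cgf's on a segment pay the means at the price `ε·L∕log L` [folklore] -/

section MGF

variable {Ω Ω' : Type*} [MeasurableSpace Ω] [MeasurableSpace Ω'] {μ : Measure Ω} {ν : Measure Ω'}
  [IsProbabilityMeasure μ] [IsProbabilityMeasure ν] {X : Ω → ℝ} {Y : Ω' → ℝ} {B : ℝ}

/-- The strip height `Y = log(2 + 2(L+1)∕(Bl₀))` is positive and the three-lines logarithm `Λ = Bl₀(cosh Y − 1) + L` sits in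
`[2L + 1, 3L + 2 + Bl₀]` (`cosh Y ∈ [e^Y∕2, e^Y]`). [bookkeeping] -/
theorem stripHeight_bounds {B l₀ L : ℝ} (hB : 0 < B) (hl₀ : 0 < l₀) (hL : 0 ≤ L) :
    0 < Real.log (2 + 2 * (L + 1) / (B * l₀)) ∧
    2 * L + 1 ≤ B * l₀ * (Real.cosh (Real.log (2 + 2 * (L + 1) / (B * l₀))) - 1) + L ∧
    B * l₀ * (Real.cosh (Real.log (2 + 2 * (L + 1) / (B * l₀))) - 1) + L ≤ 3 * L + 2 + B * l₀ := by
  have hBl : 0 < B * l₀ := mul_pos hB hl₀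
  set a : ℝ := 2 + 2 * (L + 1) / (B * l₀) with ha
  have hfrac : 0 < 2 * (L + 1) / (B * l₀) := by positivity
  have ha2 : 2 < a := by rw [ha]; linarith
  have ha0 : 0 < a := by linarith
  have hY : 0 < Real.log a := Real.log_pos (by linarith)
  have hexp : Real.exp (Real.log a) = a := Real.exp_log ha0
  have hcosh : Real.cosh (Real.log a) = (a + a⁻¹) / 2 := by
    rw [Real.cosh_eq, hexp, Real.exp_neg, hexp]
  have hainv0 : 0 < a⁻¹ := inv_pos.2 ha0
  have hainv1 : a⁻¹ ≤ 1 := inv_le_one_of_one_le₀ (by linarith)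
  have hkey : B * l₀ * (a / 2 - 1) = L + 1 := by rw [ha]; field_simp; ring
  refine ⟨hY, ?_, ?_⟩
  · -- `cosh Y − 1 ≥ a∕2 − 1 = (L+1)∕(Bl₀)`
    have h1 : a / 2 - 1 ≤ Real.cosh (Real.log a) - 1 := by rw [hcosh]; linarith
    have h2 := mul_le_mul_of_nonneg_left h1 hBl.le
    linarith
  · -- `cosh Y − 1 ≤ a − 1 = 1 + 2(L+1)∕(Bl₀)`
    have h1 : Real.cosh (Real.log a) - 1 ≤ 2 * (a / 2 - 1) + 1 := by rw [hcosh]; linarith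
    have h2 := mul_le_mul_of_nonneg_left h1 hBl.le
    nlinarith

/-- ★★★ **CLOSE CGF's ON A REAL SEGMENT PAY THE MEANS AT THE PRICE `ε·L∕log L` — THE LOG-LOG GAP CLOSES ON THE UPPER SIDE.**  Two probability
spaces, observables `|X|, |Y| ≤ B` a.e. with `B > 0`; if `|cgf_Y(t) − cgf_X(t)| ≤ ε` for every real `|t| ≤ l₀` (`0 < l₀`, `0 < ε ≤ 1`,
`L := log ε⁻¹`), then
`|∫Y dν − ∫X dμ| ≤ 2e^{1+l₀B}·ε·(3L + 2 + Bl₀) ∕ (l₀·log(2 + 2(L+1)∕(Bl₀)))`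
— module 104's `norm_deriv_le_segment_far` for the ENTIRE function `complexMGF Y ν − complexMGF X μ` (growth `2e^{B‖z‖}`, segment bound
`2εe^{l₀B}`, strip height `Y = log(2 + 2(L+1)∕(Bl₀))`), whose derivative at `0` is the difference of the means.  Order `ε·L∕log(L∕(Bl₀))` — the
order of the grid-Chebyshev witnesses of p509390. [folklore] -/
theorem abs_integral_sub_integral_le_loglog_of_cgf_close (hX : AEMeasurable X μ) (hY : AEMeasurable Y ν)
    (hXB : ∀ᵐ ω ∂μ, |X ω| ≤ B) (hYB : ∀ᵐ ω ∂ν, |Y ω| ≤ B) (hB : 0 < B) {ε l₀ : ℝ} (hl₀ : 0 < l₀) (hε0 : 0 < ε)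
    (hε1 : ε ≤ 1) (hε : ∀ t : ℝ, |t| ≤ l₀ → |cgf Y ν t - cgf X μ t| ≤ ε) :
    |∫ ω, Y ω ∂ν - ∫ ω, X ω ∂μ| ≤ 2 * Real.exp (1 + l₀ * B) * ε * (3 * Real.log ε⁻¹ + 2 + B * l₀) /
      (l₀ * Real.log (2 + 2 * (Real.log ε⁻¹ + 1) / (B * l₀))) := by
  set L : ℝ := Real.log ε⁻¹ with hLdef
  have hL0 : 0 ≤ L := Real.log_nonneg ((one_le_inv₀ hε0).2 hε1)
  obtain ⟨hYpos, hΛlo, hΛhi⟩ := stripHeight_bounds hB hl₀ hL0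
  set Yh : ℝ := Real.log (2 + 2 * (L + 1) / (B * l₀)) with hYh
  -- the entire function and its two bounds
  set f : ℂ → ℂ := fun z => complexMGF Y ν z - complexMGF X μ z with hf
  have hdY := T4GenFunBounds.differentiable_complexMGF_of_abs_le hY hYB
  have hdX := T4GenFunBounds.differentiable_complexMGF_of_abs_le hX hXB
  have hfd : Differentiable ℂ f := hdY.sub hdX
  have hgrowth : ∀ z : ℂ, ‖f z‖ ≤ 2 * Real.exp (B * ‖z‖) := fun z => by
    have h := norm_complexMGF_sub_complexMGF_le hXB hYB z
    rwa [mul_comm ‖z‖ B] at h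
  set m : ℝ := 2 * ε * Real.exp (l₀ * B) with hmdef
  have hm0 : 0 < m := by positivity
  have hm : ∀ t : ℝ, |t| ≤ l₀ → ‖f t‖ ≤ m := fun t ht => by
    show ‖complexMGF Y ν t - complexMGF X μ t‖ ≤ m
    rw [complexMGF_ofReal, complexMGF_ofReal, ← Complex.ofReal_sub, Complex.norm_real, Real.norm_eq_abs]
    refine (abs_mgf_sub_mgf_le_of_cgf_close hX hY hXB hYB (hε t ht)).trans ?_
    rw [hmdef]
    gcongr
  -- the three-lines logarithm `Λ = log(M∕m) = Bl₀(cosh Y − 1) + L`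
  have hΛ : Real.log (2 * Real.exp (B * (l₀ * Real.cosh Yh)) / m) = B * l₀ * (Real.cosh Yh - 1) + L := by
    rw [hmdef, hLdef, Real.log_inv]
    rw [show 2 * Real.exp (B * (l₀ * Real.cosh Yh)) / (2 * ε * Real.exp (l₀ * B)) =
        Real.exp (B * (l₀ * Real.cosh Yh)) / Real.exp (l₀ * B) / ε by field_simp]
    rw [Real.log_div (by positivity) hε0.ne', ← Real.exp_sub, Real.log_exp]
    ring
  have key := norm_deriv_le_segment_far hfd hB.le hl₀ hgrowth hm hm0 hYpos (by rw [hΛ]; linarith)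
  rw [hΛ] at key
  -- the derivative at `0` is the difference of the means
  have hderiv : deriv f 0 = (((∫ ω, Y ω ∂ν) - ∫ ω, X ω ∂μ : ℝ) : ℂ) := by
    have e1 : deriv f 0 = deriv (complexMGF Y ν) 0 - deriv (complexMGF X μ) 0 := deriv_sub (hdY 0) (hdX 0)
    have eY := T4GenFunBounds.iteratedDeriv_complexMGF_zero_of_abs_le hY hYB 1
    have eX := T4GenFunBounds.iteratedDeriv_complexMGF_zero_of_abs_le hX hXB 1
    rw [iteratedDeriv_one] at eY eX
    rw [e1, eY, eX, Complex.ofReal_sub]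
    simp
  rw [hderiv, Complex.norm_real, Real.norm_eq_abs] at key
  refine key.trans ?_
  -- bookkeeping: `e·m·Λ∕(l₀Y) ≤ 2e^{1+l₀B}ε(3L+2+Bl₀)∕(l₀Y)`
  have hden : 0 < l₀ * Yh := mul_pos hl₀ hYpos
  rw [div_le_div_iff_of_pos_right hden, hmdef, Real.exp_add]
  have h0 : 0 ≤ Real.exp 1 * (2 * ε * Real.exp (l₀ * B)) := by positivity
  calc Real.exp 1 * (2 * ε * Real.exp (l₀ * B)) * (B * l₀ * (Real.cosh Yh - 1) + L)
      ≤ Real.exp 1 * (2 * ε * Real.exp (l₀ * B)) * (3 * L + 2 + B * l₀) := mul_le_mul_of_nonneg_left hΛhi h0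
    _ = 2 * (Real.exp 1 * Real.exp (l₀ * B)) * ε * (3 * L + 2 + B * l₀) := by ring

end MGF

/-! ## §2 N19's DECL-target shape: the means along a `MatchingModConstants` sequence of laws on `[−1,1]` [folklore] -/

/-- ★ **THE MEANS ALONG N19's TARGET SHAPE MOVE AT THE PRICE `δ·L∕log L`.**  For probability laws `λ_K` on `[−1,1]` with
`MatchingModConstants vol l₀ δ (K t ↦ mgf λ_K t)` (`0 < l₀`) and a step with `0 < 2volδ_K ≤ 1`, writing `η := 2volδ_K`, `L := log η⁻¹`:
`|∫x dλ_{K+1} − ∫x dλ_K| ≤ 2e^{1+l₀}·η·(3L + 2 + l₀)∕(l₀·log(2 + 2(L+1)∕l₀))` (consecutive cgfs are `η`-close by module 74's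
`cgf_increment_le_of_matchingModConstants`; §1 with `B = 1`).  Compare p481156's `C·volδ_K·(1 + log⁺(2volδ_K)⁻¹)`: one `log log` better, and
of the order of p509390's witnesses. [folklore] -/
theorem abs_mean_increment_le_loglog_of_matchingModConstants {Λ : ℕ → Measure ℝ} [hP : ∀ K, IsProbabilityMeasure (Λ K)]
    (hc : ∀ K, Λ K (Set.Icc (-1 : ℝ) 1)ᶜ = 0) {vol l₀ : ℝ} (hl₀ : 0 < l₀) {δ : ℕ → ℝ}
    (hM : MatchingModConstants vol l₀ δ (fun K t => mgf id (Λ K) t)) {K : ℕ} (hpos : 0 < 2 * (vol * δ K))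
    (hle : 2 * (vol * δ K) ≤ 1) :
    |∫ x, x ∂Λ (K + 1) - ∫ x, x ∂Λ K| ≤ 2 * Real.exp (1 + l₀ * 1) * (2 * (vol * δ K)) *
      (3 * Real.log (2 * (vol * δ K))⁻¹ + 2 + 1 * l₀) /
        (l₀ * Real.log (2 + 2 * (Real.log (2 * (vol * δ K))⁻¹ + 1) / (1 * l₀))) := by
  have h := abs_integral_sub_integral_le_loglog_of_cgf_close (μ := Λ K) (ν := Λ (K + 1)) (X := id) (Y := id)
    aemeasurable_id aemeasurable_id (ae_abs_le_one_of_Icc_symm (hc K)) (ae_abs_le_one_of_Icc_symm (hc (K + 1))) one_pos hl₀ hpos hle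
    fun t ht => cgf_increment_le_of_matchingModConstants hl₀.le hM K t ht
  simpa only [id] using h

/-! ## §3 Two-sided: the grid-Chebyshev witnesses of p509390 have the same order [folklore] -/

/-- ★★ **THE LOWER SIDE IN THE SAME SHAPE.**  For every window `l₀ > 0` and every odd `M ≥ l₀e^{l₀+1} + l₀ + 2` there are probability laws
`μ, ν` on `[0,1]` and `0 < ε ≤ 4e^{l₀−M}` with cgf's `ε`-close on `|t| ≤ l₀` and
`|∫x dν − ∫x dμ| ≥ (e^{−2l₀}∕l₀)·ε·L∕log(1 + 4(L + l₀ + 2)∕l₀)`, `L = log ε⁻¹` (p509390's `exists_cgf_close_means_far`: `|ΔE| ≥ (Me^{−2l₀}∕l₀)ε`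
with `e^{l₀}·2(1 + 4M∕l₀)^{−M} ≤ ε ≤ 4e^{l₀}(l₀e^{l₀}∕(2M))^M`, whence `L ≤ M·log(1 + 4M∕l₀)` and `M ≤ L + l₀ + 2`).  Same order
`ε·L∕log(L∕l₀)` as §1's upper bound: the expectation price of the window currency is `Θ_{l₀}(ε·L∕log L)`. [folklore] -/
theorem exists_cgf_close_means_far_loglog {l₀ : ℝ} (hl₀ : 0 < l₀) {M : ℕ} (hM : Odd M)
    (hMl : l₀ * Real.exp (l₀ + 1) + l₀ + 2 ≤ M) :
    ∃ μ ν : Measure ℝ, IsProbabilityMeasure μ ∧ IsProbabilityMeasure ν ∧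
      μ (Set.Icc 0 1)ᶜ = 0 ∧ ν (Set.Icc 0 1)ᶜ = 0 ∧
      ∃ ε : ℝ, 0 < ε ∧ ε ≤ 4 * Real.exp (l₀ - M) ∧ (∀ t : ℝ, |t| ≤ l₀ → |cgf id ν t - cgf id μ t| ≤ ε) ∧
        Real.exp (-2 * l₀) / l₀ * ε * (Real.log ε⁻¹ / Real.log (1 + 4 * (Real.log ε⁻¹ + l₀ + 2) / l₀)) ≤
          |∫ x, x ∂ν - ∫ x, x ∂μ| := by
  obtain ⟨μ, ν, iμ, iν, hμ, hν, ε, hε, hlo, hhi, hwin, hmom⟩ := exists_cgf_close_means_far hl₀ hM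
  have hMpos : (0 : ℝ) < M := by have := Real.exp_pos (l₀ + 1); nlinarith
  have hM0 : 0 < M := by exact_mod_cast hMpos
  set L : ℝ := Real.log ε⁻¹ with hL
  -- the upper bound on `ε`: `ε ≤ 4e^{l₀}e^{−M}` since `l₀e^{l₀}∕(2M) ≤ e^{−1}`
  have hratio : l₀ * Real.exp l₀ / (2 * M) ≤ Real.exp (-1) := by
    rw [div_le_iff₀ (by positivity), Real.exp_neg]
    have h1 : l₀ * Real.exp (l₀ + 1) ≤ M := by linarith
    rw [Real.exp_add] at h1
    have he : 0 < Real.exp 1 := Real.exp_pos 1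
    field_simp
    nlinarith
  have hεhi : ε ≤ 4 * Real.exp (l₀ - M) := by
    refine hhi.trans ?_
    have h1 : (l₀ * Real.exp l₀ / (2 * M)) ^ M ≤ (Real.exp (-1)) ^ M :=
      pow_le_pow_left₀ (by positivity) hratio M
    rw [← Real.exp_nat_mul, show (M : ℝ) * -1 = -M by ring] at h1
    calc Real.exp l₀ * (4 * (l₀ * Real.exp l₀ / (2 * M)) ^ M) ≤ Real.exp l₀ * (4 * Real.exp (-M)) := by gcongr
      _ = 4 * Real.exp (l₀ - M) := by rw [Real.exp_sub, Real.exp_neg]; ring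
  -- `M ≤ L + l₀ + 2`
  have hlog4 : Real.log 4 ≤ 2 := by
    have : Real.log 4 = 2 * Real.log 2 := by rw [show (4 : ℝ) = 2 ^ 2 by norm_num, Real.log_pow]; norm_num
    rw [this]; linarith [Real.log_two_lt_d9]
  have hML : (M : ℝ) ≤ L + l₀ + 2 := by
    have h1 : L ≥ -Real.log (4 * Real.exp (l₀ - M)) := by
      rw [hL, Real.log_inv]; exact neg_le_neg (Real.log_le_log hε hεhi)
    rw [Real.log_mul (by norm_num) (Real.exp_pos _).ne', Real.log_exp] at h1
    linarith
  -- `L ≤ M·log(1 + 4M∕l₀)` from the lower bound on `ε`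
  have hq0 : 0 < 4 * (M : ℝ) / l₀ := by positivity
  have hq : 1 < 1 + 4 * (M : ℝ) / l₀ := by linarith
  have hLM : L ≤ M * Real.log (1 + 4 * M / l₀) := by
    have h1 : L ≤ -Real.log (Real.exp l₀ * (2 / (1 + 4 * M / l₀) ^ M)) := by
      rw [hL, Real.log_inv]; exact neg_le_neg (Real.log_le_log (by positivity) hlo)
    rw [Real.log_mul (Real.exp_pos _).ne' (by positivity), Real.log_exp, Real.log_div (by norm_num) (by positivity),
      Real.log_pow] at h1
    linarith [Real.log_two_gt_d9.le, Real.log_nonneg hq.le]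
  -- hence `M ≥ L ∕ log(1 + 4(L + l₀ + 2)∕l₀)`
  have hden : Real.log (1 + 4 * M / l₀) ≤ Real.log (1 + 4 * (L + l₀ + 2) / l₀) :=
    Real.log_le_log (by linarith) (by gcongr)
  have hden0 : 0 < Real.log (1 + 4 * M / l₀) := Real.log_pos hq
  have hfrac : L / Real.log (1 + 4 * (L + l₀ + 2) / l₀) ≤ M := by
    rcases le_or_gt 0 L with hL0 | hL0
    · calc L / Real.log (1 + 4 * (L + l₀ + 2) / l₀) ≤ L / Real.log (1 + 4 * M / l₀) :=
            div_le_div_of_nonneg_left hL0 hden0 hden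
        _ ≤ M := by rw [div_le_iff₀ hden0]; exact hLM
    · exact le_trans (div_nonpos_of_nonpos_of_nonneg hL0.le (hden0.le.trans hden)) hMpos.le
  refine ⟨μ, ν, iμ, iν, hμ, hν, ε, hε, hεhi, hwin, le_trans ?_ hmom⟩
  have h0 : 0 ≤ Real.exp (-2 * l₀) / l₀ * ε := by positivity
  calc Real.exp (-2 * l₀) / l₀ * ε * (L / Real.log (1 + 4 * (L + l₀ + 2) / l₀))
      ≤ Real.exp (-2 * l₀) / l₀ * ε * M := mul_le_mul_of_nonneg_left hfrac h0
    _ = M * Real.exp (-2 * l₀) / l₀ * ε := by ring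

end Summit.QuantumFields.YangMills.Theorems.BalabanUVNodesN19ExpectationCurrencyLogLog

end
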